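/-
Copyright (c) 2026. All rights reserved.
Released under Apache 2.0 license as described in the file LICENSE.
Authors: abc-iut cell, R-H numerics/kernel-eval seat abc-iut-H-num-1 («KUMMER-CORE»).
-/
import Literature.AnabelianGeometry.AbsoluteAnabelian.LogShellsOfUnitLog
import Mathlib.Analysis.Normed.Unbundled.SpectralNorm
import Mathlib.FieldTheory.Galois.Basic
import Mathlib.RingTheory.Norm.Transitivity
import HarnessLib

/-!
# Galois descent for `log_p(𝒪^×)`: `log_p(𝒪_K^×) ∩ M = log_p(𝒪_M^×)` for `K/M` Galois of degree prime to `p`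

Classical `p`-adic analysis (nothing here is disputed mathematics; no side is taken on [IUTchIII] Cor. 3.12).
Setting: `M`, `K` nontrivially normed fields that are normed `ℚ_p`-algebras, ultrametric and proper (finite
extensions of `ℚ_p`), and `K` a normed `M`-algebra (`‖algebraMap M K x‖ = ‖x‖`).  Write
`Λ_K := logUnits K = log_p(𝒪_K^×)` (abc-iut-S1, `LocalUnitLog.lean`) and `ℐ_K = (p*)⁻¹ • Λ_K` for the real
log-shell `logShell (PadicLogOnUnits.ofUnitLog p K)` ([AbsTopIII] Def. 5.4 (iii), `LogShellsOfUnitLog.lean`).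

## Results (all PROVED)

* §1 FUNCTORIALITY along a norm-preserving ring homomorphism `φ : M →+* K`: `logSeries (φ y) = φ (logSeries y)`
  on principal units, **`unitLog (φ u) = φ (unitLog u)`** for every `u` (`unitLog_map`), hence
  `φ '' Λ_M ⊆ Λ_K` (`image_logUnits_subset`) and the cell transfer `q ∈ qⁿ·ℐ_M → φ q ∈ (φ q)ⁿ·ℐ_K`.
* §2 ISOMETRY of `M`-algebra automorphisms of `K` (`K/M` finite): `‖σ x‖ = ‖x‖` (`norm_algEquiv`; Mathlib's
  uniqueness of the spectral norm `NormedAlgebra.norm_eq_spectralNorm` + `spectralNorm_eq_of_equiv`), so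
  `unitLog (σ u) = σ (unitLog u)` and `σ` preserves `Λ_K`.
* §3 DIVISION BY INTEGERS PRIME TO `p`: `(n : M)·x ∈ Λ_M`, `p ∤ n` ⟹ `x ∈ Λ_M` (`mem_logUnits_of_natCast_mul_mem`;
  Bezout `a·n = b·p^t + 1` with `p^t` so large that `b·p^t·x` lies in the ball `p*·𝒪_M = log_p(1 + p*·𝒪_M)`).
* §4 **DESCENT**: for `K/M` finite Galois with `p ∤ [K:M]` and `x : M`,
  `algebraMap M K x ∈ Λ_K ↔ x ∈ Λ_M` (`algebraMap_mem_logUnits_iff`; `⟹` by the norm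
  `N_{K/M} u = ∏_σ σ u` — Mathlib `Algebra.norm_eq_prod_automorphisms` — whose `log_p` is `[K:M]·x`, then §3), and the
  CELL COROLLARY for the log-shell comparison of the abc-iut R-H table: for `q : M`, `q ≠ 0`, `n : ℕ`,
  `algebraMap M K q ∈ (algebraMap M K q)ⁿ • ℐ_K ↔ q ∈ qⁿ • ℐ_M` (`algebraMap_mem_pow_smul_logShell_iff`).

Use (R-H «KUMMER-CORE», informational): at a bad place of a genuine initial Θ-datum the Kummer datum `q̲` is a
`2l`-th root of the Tate parameter, so the cell `q̲ ∈ q̲^{j²}·ℐ` may be read in the small field `ℚ_p(μ_{2l}, q̲)`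
once the (Galois, prime-to-`p`) hypotheses are checked for the tower up to the completion `K_v̲`.
References: Neukirch, *Algebraic Number Theory*, Ch. II (5.5) (the `p`-adic logarithm on units); the descent
statement itself is folklore (trace/norm argument).
-/

set_option autoImplicit false

noncomputable section

open Set Metric
open scoped Pointwise

namespace Literature.IUT.LogVolume

namespace UnitLogDescent

open Literature.AnabelianGeometry.AbsoluteAnabelian Literature.NumberTheory.Transcendental

/-! ## §0. Norm-preserving ring homomorphisms and principal units -/

section Principal

variable {M : Type*} [NontriviallyNormedField M] {K : Type*} [NontriviallyNormedField K]

/-- A norm-preserving ring homomorphism maps principal units to principal units (and only those).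
[cite: NeukirchANT1999, Ch. II (5.5)] -/
theorem isPrincipal_map_iff (φ : M →+* K) (hφ : ∀ x, ‖φ x‖ = ‖x‖) (y : M) :
    IsPrincipal (φ y) ↔ IsPrincipal y := by
  rw [IsPrincipal, IsPrincipal, ← map_one φ, ← map_sub, hφ]

/-- `φ (p*) = p*` (`p* = p` or `4` is a natural number). [cite: MochizukiAbsTopIII2015, Def 5.4 (iii) p. 126] -/
theorem map_pstar (p : ℕ) (φ : M →+* K) :
    φ ((p ^ (if p = 2 then 2 else 1) : ℕ) : M) = ((p ^ (if p = 2 then 2 else 1) : ℕ) : K) :=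
  map_natCast φ _

end Principal

/-! ## §1. Functoriality of `log_p` along norm-preserving ring homomorphisms -/

section Functoriality

variable (p : ℕ) [hp : Fact p.Prime]
variable {M : Type*} [NontriviallyNormedField M] [instM : NormedAlgebra ℚ_[p] M] [IsUltrametricDist M]
  [ProperSpace M]
variable {K : Type*} [NontriviallyNormedField K] [instK : NormedAlgebra ℚ_[p] K] [IsUltrametricDist K]
  [CompleteSpace K]
variable (φ : M →+* K) (hφ : ∀ x, ‖φ x‖ = ‖x‖)
include instM instK hφ

omit [IsUltrametricDist M] [ProperSpace M] [IsUltrametricDist K] in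
/-- **The logarithmic series commutes with norm-preserving ring homomorphisms** on principal units:
`L(φ y) = φ (L y)` (`φ` is an isometry, hence continuous, and maps the series termwise).
[cite: NeukirchANT1999, Ch. II (5.4)] -/
theorem logSeries_map [CompleteSpace M] {y : M} (hy : IsPrincipal y) :
    logSeries (φ y) = φ (logSeries y) := by
  have hcont : Continuous φ := (AddMonoidHomClass.isometry_of_norm φ hφ).continuous
  have hyK : IsPrincipal (φ y) := (isPrincipal_map_iff φ hφ y).2 hy
  have h1 := (hasSum_logSeries p hy).map φ hcont
  have h2 := hasSum_logSeries p hyK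
  have heq : (φ ∘ fun n : ℕ => -((1 - y) ^ (n + 1)) / (n + 1 : M)) =
      fun n : ℕ => -((1 - φ y) ^ (n + 1)) / (n + 1 : K) := by
    funext n
    simp only [Function.comp_apply, map_div₀, map_neg, map_pow, map_sub, map_one, map_add, map_natCast]
  rw [heq] at h1
  exact h2.unique h1

/-- **`log_p` commutes with norm-preserving ring homomorphisms**: `log_p (φ u) = φ (log_p u)` for EVERY `u`
(units: choose `k ≥ 1` with `u^k` principal — the same `k` works for `φ u` — and use `logSeries_map`;
non-units: both sides are the junk value `0`). [cite: NeukirchANT1999, Ch. II (5.5)] -/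
theorem unitLog_map (u : M) : unitLog (φ u) = φ (unitLog u) := by
  haveI := IwasawaLog.charZero p (F := K)
  by_cases hu : ‖u‖ = 1
  · obtain ⟨k, hk, hkP⟩ := exists_pow_isPrincipal hu
    have hkP' : IsPrincipal ((φ u) ^ k) := by
      rw [← map_pow]; exact (isPrincipal_map_iff φ hφ _).2 hkP
    rw [unitLog_eq_inv_mul_logSeries p hk hkP', unitLog_eq_inv_mul_logSeries p hk hkP, ← map_pow,
      logSeries_map p φ hφ hkP, map_mul, map_inv₀, map_natCast]
  · have hu' : ‖φ u‖ ≠ 1 := by rwa [hφ]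
    rw [unitLog_of_norm_ne_one hu, unitLog_of_norm_ne_one hu', map_zero]

/-- `φ` maps `log_p(𝒪_M^×)` into `log_p(𝒪_K^×)`. [cite: NeukirchANT1999, Ch. II (5.5)] -/
theorem image_logUnits_subset : φ '' logUnits M ⊆ logUnits K := by
  rintro _ ⟨z, ⟨u, hu, rfl⟩, rfl⟩
  rw [mem_setOf_eq] at hu
  exact ⟨φ u, by rw [mem_setOf_eq, hφ, hu], unitLog_map p φ hφ u⟩

/-- Membership transfer: `x ∈ Λ_M ⟹ φ x ∈ Λ_K`. [cite: NeukirchANT1999, Ch. II (5.5)] -/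
theorem map_mem_logUnits {x : M} (hx : x ∈ logUnits M) : φ x ∈ logUnits K :=
  image_logUnits_subset p φ hφ ⟨x, hx, rfl⟩

end Functoriality

/-! ## The cell `q ∈ qⁿ • ℐ` as a membership in `log_p(𝒪^×)` -/

section Cell

variable (p : ℕ) [hp : Fact p.Prime]
variable {K : Type*} [NontriviallyNormedField K] [instK : NormedAlgebra ℚ_[p] K] [IsUltrametricDist K]
  [CompleteSpace K]

/-- **The cell in `Λ`-form**: for `q ≠ 0`, `q ∈ qⁿ • ℐ_K ↔ p* · ((qⁿ)⁻¹ · q) ∈ log_p(𝒪_K^×)` (`ℐ_K = (p*)⁻¹ • Λ_K`).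
[cite: MochizukiAbsTopIII2015, Def 5.4 (iii) p. 126] -/
theorem mem_pow_smul_logShell_iff {q : K} (hq : q ≠ 0) (n : ℕ) :
    q ∈ q ^ n • logShell (PadicLogOnUnits.ofUnitLog p K) ↔
      ((p ^ (if p = 2 then 2 else 1) : ℕ) : K) * ((q ^ n)⁻¹ * q) ∈ logUnits K := by
  have hps : ((p ^ (if p = 2 then 2 else 1) : ℕ) : K) ≠ 0 := pstarNat_cast_ne_zero p K
  have hqn : q ^ n ≠ 0 := pow_ne_zero n hq
  rw [logShell_ofUnitLog, smul_smul, Set.mem_smul_set_iff_inv_smul_mem₀ (mul_ne_zero hqn (inv_ne_zero hps)),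
    smul_eq_mul, mul_inv, inv_inv,
    show (q ^ n)⁻¹ * ((p ^ (if p = 2 then 2 else 1) : ℕ) : K) * q =
      ((p ^ (if p = 2 then 2 else 1) : ℕ) : K) * ((q ^ n)⁻¹ * q) by ring]

end Cell

section CellTransfer

variable (p : ℕ) [hp : Fact p.Prime]
variable {M : Type*} [NontriviallyNormedField M] [instM : NormedAlgebra ℚ_[p] M] [IsUltrametricDist M]
  [ProperSpace M]
variable {K : Type*} [NontriviallyNormedField K] [instK : NormedAlgebra ℚ_[p] K] [IsUltrametricDist K]
  [CompleteSpace K]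
variable (φ : M →+* K) (hφ : ∀ x, ‖φ x‖ = ‖x‖)
include instM instK hφ

/-- **Cell transfer (upward, unconditional)**: `q ∈ qⁿ • ℐ_M ⟹ φ q ∈ (φ q)ⁿ • ℐ_K` along any norm-preserving ring
homomorphism (`φ '' Λ_M ⊆ Λ_K`). [cite: MochizukiAbsTopIII2015, Def 5.4 (iii) p. 126] -/
theorem map_mem_pow_smul_logShell {q : M} (hq : q ≠ 0) {n : ℕ}
    (h : q ∈ q ^ n • logShell (PadicLogOnUnits.ofUnitLog p M)) :
    φ q ∈ (φ q) ^ n • logShell (PadicLogOnUnits.ofUnitLog p K) := by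
  have hq' : φ q ≠ 0 := (map_ne_zero φ).2 hq
  rw [mem_pow_smul_logShell_iff p hq']
  rw [mem_pow_smul_logShell_iff p hq] at h
  have := map_mem_logUnits p φ hφ h
  rwa [map_mul, map_mul, map_inv₀, map_pow, map_pstar p φ] at this

end CellTransfer

/-! ## §2. `M`-algebra automorphisms of `K` are isometries -/

section Isometry

variable (M : Type*) [NontriviallyNormedField M] [IsUltrametricDist M] [ProperSpace M]
variable {K : Type*} [NontriviallyNormedField K] [NormedAlgebra M K] [FiniteDimensional M K]

/-- **Automorphisms are isometries**: `‖σ x‖ = ‖x‖` for `σ : K ≃ₐ[M] K`, `K/M` finite — the given norm of `K` is the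
spectral norm over the complete ultrametric field `M` (Mathlib `NormedAlgebra.norm_eq_spectralNorm`), which is
`σ`-invariant (`spectralNorm_eq_of_equiv`). [cite: NeukirchANT1999, Ch. II (4.8)] -/
theorem norm_algEquiv (σ : K ≃ₐ[M] K) (x : K) : ‖σ x‖ = ‖x‖ := by
  rw [NormedAlgebra.norm_eq_spectralNorm M (σ x), NormedAlgebra.norm_eq_spectralNorm M x,
    ← spectralNorm_eq_of_equiv]

variable (p : ℕ) [hp : Fact p.Prime] [instK : NormedAlgebra ℚ_[p] K] [IsUltrametricDist K] [ProperSpace K]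
include instK

/-- `log_p (σ u) = σ (log_p u)` for every `M`-algebra automorphism `σ` of `K`. [cite: NeukirchANT1999, Ch. II (5.5)] -/
theorem unitLog_algEquiv (σ : K ≃ₐ[M] K) (u : K) : unitLog (σ u) = σ (unitLog u) :=
  unitLog_map p (M := K) (K := K) (σ : K →+* K) (norm_algEquiv M σ) u

end Isometry

/-! ## §3. Division by integers prime to `p` inside `log_p(𝒪^×)` -/

section Division

variable (p : ℕ) [hp : Fact p.Prime]
variable {M : Type*} [NontriviallyNormedField M] [instM : NormedAlgebra ℚ_[p] M] [IsUltrametricDist M]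
  [ProperSpace M]
include instM

/-- `log_p` of a finite product of units is the sum of the `log_p`'s. [cite: NeukirchANT1999, Ch. II (5.5)] -/
theorem unitLog_prod {ι : Type*} (s : Finset ι) (f : ι → M) (hf : ∀ i ∈ s, ‖f i‖ = 1) :
    unitLog (∏ i ∈ s, f i) = ∑ i ∈ s, unitLog (f i) := by
  classical
  induction s using Finset.induction_on with
  | empty => simp [unitLog_one p]
  | insert a s ha ih =>
    have hfa : ‖f a‖ = 1 := hf a (Finset.mem_insert_self a s)
    have hfs : ∀ i ∈ s, ‖f i‖ = 1 := fun i hi => hf i (Finset.mem_insert_of_mem hi)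
    have hprod : ‖∏ i ∈ s, f i‖ = 1 := by
      rw [norm_prod]; exact Finset.prod_eq_one hfs
    rw [Finset.prod_insert ha, Finset.sum_insert ha, unitLog_mul p hfa hprod, ih hfs]

/-- Every element of the ball `p*·𝒪_M` is `log_p` of a unit (indeed of a principal unit in `1 + p*·𝒪_M`:
[AbsTopIII] Def. 5.4 (iii)'s bijection, `PadicLogOnUnits.ofUnitLog`). [cite: MochizukiAbsTopIII2015, Def 5.4 (iii) p. 126] -/
theorem mem_logUnits_of_norm_le_pstar {z : M} (hz : ‖z‖ ≤ ‖((p ^ (if p = 2 then 2 else 1) : ℕ) : M)‖) :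
    z ∈ logUnits M := by
  have himg := (PadicLogOnUnits.ofUnitLog p M).image_principalUnits
  rw [PadicLogOnUnits.ofUnitLog_log, PadicLogOnUnits.ofUnitLog_pstar] at himg
  have hz' : z ∈ closedBall (0 : M) ‖((p ^ (if p = 2 then 2 else 1) : ℕ) : M)‖ := by
    rwa [mem_closedBall, dist_zero_right]
  rw [← himg] at hz'
  obtain ⟨y, hy, hyz⟩ := hz'
  have hyP : IsPrincipal y := by
    rw [mem_closedBall, dist_eq_norm, norm_sub_rev] at hy
    exact hy.trans_lt (norm_pstarNat_cast_lt_one p M)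
  exact ⟨y, hyP.norm_eq_one, hyz⟩

/-- **Division by `n` prime to `p`**: `(n : M)·x ∈ log_p(𝒪_M^×)` and `p ∤ n` imply `x ∈ log_p(𝒪_M^×)`.
Proof: pick `t ≥ 1` with `p^{−t}·‖x‖ ≤ ‖p*‖` and `a, b ∈ ℕ` with `n·a = p^t·b + 1` (`n` is invertible mod `p^t`); then
`x = a·(n·x) − b·p^t·x = log_p(ν^a) + log_p(y)` with `y` a principal unit, `log_p y = −b·p^t·x ∈ p*·𝒪_M`.
[cite: NeukirchANT1999, Ch. II (5.5)] -/
theorem mem_logUnits_of_natCast_mul_mem {n : ℕ} (hn : ¬ p ∣ n) {x : M} (hx : (n : M) * x ∈ logUnits M) :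
    x ∈ logUnits M := by
  haveI := IwasawaLog.charZero p (F := M)
  have hP : p.Prime := Fact.out
  obtain ⟨ν, hν, hνx⟩ := (mem_logUnits_iff).1 hx
  -- the radius `‖p*‖` and a power `p^t` pushing `x` into the ball
  set r : ℝ := ‖((p ^ (if p = 2 then 2 else 1) : ℕ) : M)‖ with hr
  have hr0 : 0 < r := norm_pos_iff.2 (pstarNat_cast_ne_zero p M)
  have hp1 : (1 : ℝ) < p := by exact_mod_cast hP.one_lt
  have hpinv : ((p : ℝ)⁻¹) < 1 := inv_lt_one_of_one_lt₀ hp1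
  have hx1 : (0 : ℝ) < ‖x‖ + 1 := by positivity
  obtain ⟨t₀, ht₀⟩ := exists_pow_lt_of_lt_one (div_pos hr0 hx1) hpinv
  set t : ℕ := t₀ + 1 with ht
  have hpt : ((p : ℝ)⁻¹) ^ t * ‖x‖ ≤ r := by
    have h1 : ((p : ℝ)⁻¹) ^ t ≤ ((p : ℝ)⁻¹) ^ t₀ := by
      rw [ht, pow_succ]; exact mul_le_of_le_one_right (by positivity) hpinv.le
    have hx1' : ‖x‖ ≤ ‖x‖ + 1 := by linarith
    calc ((p : ℝ)⁻¹) ^ t * ‖x‖ ≤ ((p : ℝ)⁻¹) ^ t₀ * (‖x‖ + 1) := by gcongr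
      _ ≤ r / (‖x‖ + 1) * (‖x‖ + 1) := mul_le_mul_of_nonneg_right ht₀.le hx1.le
      _ = r := div_mul_cancel₀ r hx1.ne'
  -- Bezout: n * a = p^t * b + 1
  have hcop : Nat.Coprime n (p ^ t) :=
    Nat.Coprime.pow_right t ((Nat.Prime.coprime_iff_not_dvd hP).2 hn).symm
  have hpt1 : 1 < p ^ t := Nat.one_lt_pow (by omega) hP.one_lt
  obtain ⟨a, -, ha⟩ := Nat.exists_mul_mod_eq_one_of_coprime hcop hpt1
  set b : ℕ := n * a / p ^ t with hb
  have hab : n * a = p ^ t * b + 1 := by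
    have := Nat.div_add_mod (n * a) (p ^ t)
    rw [ha] at this
    rw [hb]; exact this.symm
  -- the small element z := -(b * p^t * x) is a log of a unit
  have hz : ‖-((b : M) * (p : M) ^ t * x)‖ ≤ r := by
    rw [norm_neg, norm_mul, norm_mul, norm_pow, IwasawaLog.norm_natCast p p, Padic.norm_p]
    calc ‖(b : M)‖ * (((p : ℝ)⁻¹) ^ t) * ‖x‖ ≤ 1 * (((p : ℝ)⁻¹) ^ t) * ‖x‖ := by
          gcongr; exact IwasawaLog.norm_natCast_le_one p b
      _ = ((p : ℝ)⁻¹) ^ t * ‖x‖ := by ring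
      _ ≤ r := hpt
  obtain ⟨y, hy, hyz⟩ := (mem_logUnits_iff).1 (mem_logUnits_of_norm_le_pstar p hz)
  -- assemble: x = a * (n * x) + z = log (ν^a * y)
  have hνa : ‖ν ^ a‖ = 1 := by rw [norm_pow, hν, one_pow]
  refine ⟨ν ^ a * y, by rw [mem_setOf_eq, norm_mul, hνa, hy, one_mul], ?_⟩
  rw [unitLog_mul p hνa hy, unitLog_pow p hν, hνx, hyz]
  have hcast : (n : M) * (a : M) = (p : M) ^ t * (b : M) + 1 := by exact_mod_cast hab
  linear_combination x * hcast

end Division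

/-! ## §4. Galois descent -/

section Descent

variable (p : ℕ) [hp : Fact p.Prime]
variable (M : Type*) [NontriviallyNormedField M] [instM : NormedAlgebra ℚ_[p] M] [IsUltrametricDist M]
  [ProperSpace M]
variable {K : Type*} [NontriviallyNormedField K] [instK : NormedAlgebra ℚ_[p] K] [IsUltrametricDist K]
  [ProperSpace K]
variable [NormedAlgebra M K] [FiniteDimensional M K]
include instM instK

omit [FiniteDimensional M K] in
/-- Upward direction along `algebraMap` (no Galois hypothesis): `x ∈ Λ_M ⟹ algebraMap M K x ∈ Λ_K`.
[cite: NeukirchANT1999, Ch. II (5.5)] -/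
theorem algebraMap_mem_logUnits {x : M} (hx : x ∈ logUnits M) : algebraMap M K x ∈ logUnits K :=
  map_mem_logUnits p (algebraMap M K) (norm_algebraMap' K) hx

/-- **GALOIS DESCENT FOR `log_p(𝒪^×)`.** Let `K/M` be a finite Galois extension of `p`-adic fields (normed
`M`-algebra) with `p ∤ [K:M]`. If `x ∈ M` becomes a logarithm of a unit in `K`, it already is one in `M`:
`algebraMap M K x = log_p u`, `u ∈ 𝒪_K^×` ⟹ `log_p (N_{K/M} u) = Σ_σ σ(log_p u) = [K:M]·x` with `N_{K/M} u = ∏_σ σ u ∈ 𝒪_M^×`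
(Mathlib `Algebra.norm_eq_prod_automorphisms`; `σ` isometric, §2), and `[K:M]` is prime to `p` (§3). [cite: NeukirchANT1999, Ch. II (5.5)] -/
theorem mem_logUnits_of_algebraMap_mem [IsGalois M K] (hdeg : ¬ p ∣ Module.finrank M K) {x : M}
    (hx : algebraMap M K x ∈ logUnits K) : x ∈ logUnits M := by
  classical
  haveI := IwasawaLog.charZero p (F := K)
  obtain ⟨u, hu, hux⟩ := (mem_logUnits_iff).1 hx
  have hσu : ∀ σ : K ≃ₐ[M] K, ‖σ u‖ = 1 := fun σ => by rw [norm_algEquiv M σ, hu]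
  -- the norm ν = N_{K/M} u and its image ∏ σ u
  have hprod : algebraMap M K (Algebra.norm M u) = ∏ σ : K ≃ₐ[M] K, σ u :=
    Algebra.norm_eq_prod_automorphisms M u
  have hν1 : ‖Algebra.norm M u‖ = 1 := by
    rw [← norm_algebraMap' K (Algebra.norm M u), hprod, norm_prod]
    exact Finset.prod_eq_one fun σ _ => hσu σ
  -- log of the product
  have hlog : unitLog (algebraMap M K (Algebra.norm M u)) =
      ((Module.finrank M K : ℕ) : K) * algebraMap M K x := by
    rw [hprod, unitLog_prod p (M := K) Finset.univ (fun σ : K ≃ₐ[M] K => σ u) (fun σ _ => hσu σ)]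
    simp_rw [unitLog_algEquiv M p, hux, AlgEquiv.commutes]
    rw [Finset.sum_const, Finset.card_univ, nsmul_eq_mul, ← Nat.card_eq_fintype_card,
      IsGalois.card_aut_eq_finrank]
  have hlogM : unitLog (Algebra.norm M u) = ((Module.finrank M K : ℕ) : M) * x := by
    apply (algebraMap M K).injective
    rw [← unitLog_map p (algebraMap M K) (norm_algebraMap' K), hlog, map_mul, map_natCast]
  exact mem_logUnits_of_natCast_mul_mem p hdeg ⟨Algebra.norm M u, hν1, hlogM⟩

/-- **`Λ_K ∩ M = Λ_M`** (membership form): for `K/M` finite Galois with `p ∤ [K:M]`,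
`algebraMap M K x ∈ log_p(𝒪_K^×) ↔ x ∈ log_p(𝒪_M^×)`. [cite: NeukirchANT1999, Ch. II (5.5)] -/
theorem algebraMap_mem_logUnits_iff [IsGalois M K] (hdeg : ¬ p ∣ Module.finrank M K) (x : M) :
    algebraMap M K x ∈ logUnits K ↔ x ∈ logUnits M :=
  ⟨mem_logUnits_of_algebraMap_mem p M hdeg, algebraMap_mem_logUnits p M⟩

/-- **CELL DESCENT** (the log-shell comparison of [IUTchIII] Rmk. 3.12.2 (ii) / the abc-iut R-H cell, read in a
subfield): for `K/M` finite Galois with `p ∤ [K:M]`, `q ∈ M`, `q ≠ 0`, `n : ℕ`: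
`algebraMap M K q ∈ (algebraMap M K q)ⁿ • ℐ_K ↔ q ∈ qⁿ • ℐ_M`. [cite: MochizukiAbsTopIII2015, Def 5.4 (iii) p. 126] -/
theorem algebraMap_mem_pow_smul_logShell_iff [IsGalois M K] (hdeg : ¬ p ∣ Module.finrank M K) {q : M}
    (hq : q ≠ 0) (n : ℕ) :
    algebraMap M K q ∈ (algebraMap M K q) ^ n • logShell (PadicLogOnUnits.ofUnitLog p K) ↔
      q ∈ q ^ n • logShell (PadicLogOnUnits.ofUnitLog p M) := by
  have hq' : algebraMap M K q ≠ 0 := (map_ne_zero _).2 hq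
  rw [mem_pow_smul_logShell_iff p hq', mem_pow_smul_logShell_iff p hq, ← map_pow, ← map_inv₀, ← map_mul,
    ← map_pstar p (algebraMap M K), ← map_mul, algebraMap_mem_logUnits_iff p M hdeg]

/-- **NEGATIVE CELLS DESCEND** (packaging for the R-H table): if the cell FAILS in the subfield `M` then it fails in
`K`. [cite: MochizukiAbsTopIII2015, Def 5.4 (iii) p. 126] -/
theorem not_mem_pow_smul_logShell_of_subfield [IsGalois M K] (hdeg : ¬ p ∣ Module.finrank M K) {q : M}
    (hq : q ≠ 0) {n : ℕ} (h : q ∉ q ^ n • logShell (PadicLogOnUnits.ofUnitLog p M)) :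
    algebraMap M K q ∉ (algebraMap M K q) ^ n • logShell (PadicLogOnUnits.ofUnitLog p K) :=
  fun hK => h ((algebraMap_mem_pow_smul_logShell_iff p M hdeg hq n).1 hK)

end Descent

end UnitLogDescent

end Literature.IUT.LogVolume

end
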